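import Mathlib
import Literature.RingTheory.TightClosure.TightClosure
import Literature.LinearAlgebra.Matrix.IntegerLinearSolvability
import HarnessLib

/-!
# Exchanging one parameter of a tightly closed parameter ideal

Support file for crux `FRationalModification` (route `ResolutionOfSingularities/FrobeniusLadder`,
line `Sketch`, stub `stub_exchange`), in the tight-closure vocabulary of
`Literature.RingTheory.TightClosure` (`frobeniusPower`, `tightClosure`, `IsTightlyClosed`,
`IsSystemOfParameters`).

Let `(R, 𝔪)` be a Noetherian local domain of prime characteristic `p` and dimension `d + 1` which is
Cohen–Macaulay in the sense that every system of parameters is a weakly regular sequence (in the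
given order). If the parameter ideal `A = (a, u)` (`u : Fin d → R`, `rad A = 𝔪`) is tightly closed and
`a ∈ B = (b, u)`, then `B` is tightly closed (`stub_exchange`).

Proof (one-generator linkage, in the style of Fedder–Watanabe 1989, proof of Prop. 2.2): write
`a = β b + z` with `z ∈ U = (u)`. Then `β B ⊆ A`, hence `β^q B^[q] ⊆ A^[q]` for every `q = p^e`, so
`β B^* ⊆ A^* = A`. For `y ∈ B^*` write `β y = λ a + z'` (`z' ∈ U`); substituting `a` gives
`β (y - λ b) ∈ U`. Finally `β` is a non-zero-divisor modulo `U`: `a` is one, because `(u, a)` is a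
system of parameters, hence a weakly regular sequence (colon capturing, `mem_span_of_mul_mem`), and
`a x = β b x + z x`. So `y - λ b ∈ U` and `y ∈ B`.

No hypothesis on `b` is needed (if `b` is a unit then `B = R`, which is trivially tightly closed).

The list identity `List.ofFn (Fin.snoc u a) = List.ofFn u ++ [a]` is reused from
`Literature.LinearAlgebra.Matrix.IntSolve.ofFn_snoc` (hence the import of
`Literature.LinearAlgebra.Matrix.IntegerLinearSolvability`).

## References

* [FedderWatanabe1989] R. Fedder, K.-i. Watanabe, *A characterization of F-regularity in terms of
  F-purity*, in: Commutative Algebra (MSRI Publ. 15), Springer 1989, 227–245, proof of Prop. 2.2.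
-/

-- the summit and its single problem share the name `ResolutionOfSingularities` (path-aligned namespace)
set_option linter.dupNamespace false

namespace Summit.ResolutionOfSingularities.ResolutionOfSingularities.Theorems.FRationalModification.Exchange

open IsLocalRing RingTheory.Sequence Literature.RingTheory.TightClosure

variable {R : Type*} [CommRing R]

/-- `Ideal.ofList (List.ofFn u) = Ideal.span (Set.range u)`: the ideal of the list of values of a
tuple is the ideal generated by its range. [folklore] -/
theorem ofList_ofFn {d : ℕ} (u : Fin d → R) :
    Ideal.ofList (List.ofFn u) = Ideal.span (Set.range u) := by
  change Ideal.span {r | r ∈ List.ofFn u} = Ideal.span (Set.range u)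
  congr 1
  ext r
  rw [Set.mem_setOf_eq, List.mem_ofFn']

/-- If `β x ∈ A` for every generator `x ∈ S`, then `β y ∈ A` for every `y ∈ span S`
(i.e. `β · span S ⊆ A`). [folklore] -/
theorem mul_mem_of_forall_mem_span {S : Set R} {A : Ideal R} {β : R}
    (h : ∀ x ∈ S, β * x ∈ A) {y : R} (hy : y ∈ Ideal.span S) : β * y ∈ A := by
  induction hy using Submodule.span_induction with
  | mem x hx => exact h x hx
  | zero => rw [mul_zero]; exact zero_mem A
  | add x y _ _ hx hy => rw [mul_add]; exact add_mem hx hy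
  | smul r x _ hx => rw [smul_eq_mul, mul_left_comm]; exact Ideal.mul_mem_left A r hx

/-- **Colon capturing for the last parameter.** In a local ring of dimension `d + 1` in which every
system of parameters is a weakly regular sequence (in the given order), if `rad (a, u) = 𝔪` with
`u : Fin d → R` then `a` is a non-zero-divisor modulo `(u)`: `a x ∈ (u) ⇒ x ∈ (u)` (apply the
hypothesis to the system of parameters `(u, a) = Fin.snoc u a`, listed as `List.ofFn u ++ [a]` by
`Literature.LinearAlgebra.Matrix.IntSolve.ofFn_snoc`, whose last member `a` is regular on `R/(u)`).
[folklore] -/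
theorem mem_span_of_mul_mem [IsLocalRing R]
    (hCM : ∀ ⦃n : ℕ⦄ (s : Fin n → R), IsSystemOfParameters s → IsWeaklyRegular R (List.ofFn s))
    {d : ℕ} (hd : ringKrullDim R = ((d + 1 : ℕ) : WithBot ℕ∞)) {a : R} {u : Fin d → R}
    (ha : (Ideal.span (insert a (Set.range u))).radical = maximalIdeal R) {x : R}
    (hx : a * x ∈ Ideal.span (Set.range u)) : x ∈ Ideal.span (Set.range u) := by
  have hsop : IsSystemOfParameters (Fin.snoc u a : Fin (d + 1) → R) :=
    ⟨hd, by rw [Fin.range_snoc]; exact ha⟩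
  have hreg := hCM _ hsop
  rw [Literature.LinearAlgebra.Matrix.IntSolve.ofFn_snoc, isWeaklyRegular_append_iff,
    isWeaklyRegular_singleton_iff, ofList_ofFn] at hreg
  have key : ∀ y : R, y ∈ (Ideal.span (Set.range u) • ⊤ : Submodule R R) ↔
      y ∈ Ideal.span (Set.range u) := fun y => by
    rw [Ideal.smul_eq_mul, Ideal.mul_top]
  exact (key x).mp (mem_of_isSMulRegular_quotient_of_smul_mem hreg.2 ((key _).mpr hx))

/-- **Exchanging one parameter** (stub `stub_exchange` of crux `FRationalModification`, line
`Sketch`): `(R, 𝔪)` a Noetherian local domain of characteristic `p` and dimension `d + 1`,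
Cohen–Macaulay (every system of parameters is a weakly regular sequence); if the parameter ideal
`(a, u)` (`rad (a, u) = 𝔪`) is tightly closed and `a ∈ (b, u)`, then `(b, u)` is tightly closed.
Write `a = β b + z`, `z ∈ (u)`; then `β · (b, u) ⊆ (a, u)`, so for `y ∈ (b, u)^*` one has
`β y ∈ (a, u)^* = (a, u)`, `β y = λ a + z'`, `β (y - λ b) = λ z + z' ∈ (u)`; and `β` is regular modulo
`(u)` because `a` is (`mem_span_of_mul_mem`) and `a x = β b x + z x`; so `y - λ b ∈ (u)` and
`y ∈ (b, u)`. [cite: FedderWatanabe1989, proof of Prop. 2.2] -/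
theorem stub_exchange (p : ℕ) [Fact p.Prime] {R : Type*} [CommRing R] [IsDomain R]
    [IsNoetherianRing R] [IsLocalRing R] [CharP R p]
    (hCM : ∀ ⦃n : ℕ⦄ (s : Fin n → R), IsSystemOfParameters s → IsWeaklyRegular R (List.ofFn s))
    {d : ℕ} (hd : ringKrullDim R = ((d + 1 : ℕ) : WithBot ℕ∞)) {a b : R} {u : Fin d → R}
    (ha : (Ideal.span (insert a (Set.range u))).radical = maximalIdeal R)
    (hab : a ∈ Ideal.span (insert b (Set.range u)))
    (htc : IsTightlyClosed p (Ideal.span (insert a (Set.range u)))) :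
    IsTightlyClosed p (Ideal.span (insert b (Set.range u))) := by
  have hUA : Ideal.span (Set.range u) ≤ Ideal.span (insert a (Set.range u)) :=
    Ideal.span_mono (Set.subset_insert _ _)
  have hUB : Ideal.span (Set.range u) ≤ Ideal.span (insert b (Set.range u)) :=
    Ideal.span_mono (Set.subset_insert _ _)
  have haA : a ∈ Ideal.span (insert a (Set.range u)) := Ideal.subset_span (Set.mem_insert _ _)
  have hbB : b ∈ Ideal.span (insert b (Set.range u)) := Ideal.subset_span (Set.mem_insert _ _)
  -- `a = β b + z` with `z ∈ (u)`
  obtain ⟨β, z, hz, habz⟩ := Ideal.mem_span_insert.mp hab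
  -- (1) `β · (b, u) ⊆ (a, u)`
  have hβB : ∀ w ∈ Ideal.span (insert b (Set.range u)),
      β * w ∈ Ideal.span (insert a (Set.range u)) := by
    intro w hw
    refine mul_mem_of_forall_mem_span ?_ hw
    rintro x (rfl | ⟨i, rfl⟩)
    · have hβx : β * x = a - z := by rw [habz]; ring
      rw [hβx]
      exact sub_mem haA (hUA hz)
    · exact Ideal.mul_mem_left _ _ (hUA (Ideal.subset_span ⟨i, rfl⟩))
  -- (2) `β` is a non-zero-divisor modulo `(u)`, because `a` is
  have hβU : ∀ x : R, β * x ∈ Ideal.span (Set.range u) → x ∈ Ideal.span (Set.range u) := by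
    intro x hx
    refine mem_span_of_mul_mem hCM hd ha ?_
    have hax : a * x = b * (β * x) + z * x := by rw [habz]; ring
    rw [hax]
    exact add_mem (Ideal.mul_mem_left _ _ hx) (Ideal.mul_mem_right _ _ hz)
  -- (3) `β · (b, u)^* ⊆ (a, u)^* = (a, u)`, and conclude
  rw [isTightlyClosed_iff_le]
  intro y hy
  obtain ⟨c, hc, hcy⟩ := (mem_tightClosure_iff_of_isDomain p).mp hy
  have hβy : β * y ∈ tightClosure p (Ideal.span (insert a (Set.range u))) := by
    refine (mem_tightClosure_iff_of_isDomain p).mpr ⟨c, hc, fun e => ?_⟩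
    have hcβ : c * (β * y) ^ p ^ e = β ^ p ^ e * (c * y ^ p ^ e) := by ring
    rw [hcβ]
    have h := hcy e
    rw [frobeniusPower_def] at h
    refine mul_mem_of_forall_mem_span ?_ h
    rintro _ ⟨w, hw, rfl⟩
    show β ^ p ^ e * w ^ p ^ e ∈ _
    rw [← mul_pow]
    exact pow_mem_frobeniusPower (hβB w hw)
  obtain ⟨lam, z', hz', hlam⟩ := Ideal.mem_span_insert.mp (((isTightlyClosed_iff_le p).mp htc) hβy)
  -- `β (y - λ b) = λ z + z' ∈ (u)`
  have hdiff : β * (y - lam * b) ∈ Ideal.span (Set.range u) := by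
    have hβ' : β * (y - lam * b) = lam * z + z' := by
      rw [habz] at hlam
      linear_combination hlam
    rw [hβ']
    exact add_mem (Ideal.mul_mem_left _ _ hz) hz'
  have hy' : y = lam * b + (y - lam * b) := by ring
  rw [hy']
  exact add_mem (Ideal.mul_mem_left _ _ hbB) (hUB (hβU _ hdiff))

end Summit.ResolutionOfSingularities.ResolutionOfSingularities.Theorems.FRationalModification.Exchange
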